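import Summits.AnomalousDissipation.AnomalousDissipation.Theorems.SolenoidalFractalHomogenisationRealisedQuasiStaticCellLawSlavedLadderFast
import HarnessLib

/-!
# K2R `RealisedQuasiStaticCellLaw`, line `floquet-bloch`, stub `stub_upperSome`: the slaved-ladder functional, LOWER form
# (weak-coupling regime; per-window LOWER bound of the slow energy with the second-order Taylor exponent)

Summits-side helper (everything proved; no definitions, no named facts; `--supports stmt-AnomalousDissipation-20446`).
Mirror image of `…SlavedLadder` (stub `stub_lowSectorDecay`, UPPER bound): for the three-term ladder
`v_J' = −Λ(d_J v_J + g(t)(s_{J−1} v_{J−1} − s_J v_{J+1}))` on a window `W ∋ 0, ±1` with the first-order slaving profile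
`h₁ = −g s₀/(d₁ − d₀)`, `h₋₁ = g s₋₁/(d₋₁ − d₀)`, `h_J = 0` otherwise, the functional with the OPPOSITE sign of the fast weight,
`Ψ(t) = ‖v₀‖² − β·Σ_{J≠0} ‖v_J − h_J(t) v₀‖²`,
is bounded BELOW along the ladder:

* `slavedLadder_slow_ge`: the two-sided form of the slow-mode identity of `slavedLadder_slow_le` —
  `2 Re(v₀' conj v₀) ≥ −2Λ(d₀ + g²σ)‖v₀‖² − 2|g|Λγ ‖v₀‖ √F`, `σ = s₋₁²/(d₋₁−d₀) + s₀²/(d₁−d₀)`, `γ² = s₀² + s₋₁²`;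
* `slavedLadder_pointwise_ge`: `Ψ' ≥ −2(Λ(d₀ + (1+ε) σ g(t)²) + μ₀) Ψ` whenever `γ² ≤ β Δ ε σ`, with the slack
  `μ₀ = 4βγ²(Λ g_T³ σ + g_D + Λ g_T²)²/(Λ Δ³)` of `…SlavedLadder` and the weak-coupling hypothesis in the form
  `g_T²(4γ²/Δ + 2(1+ε)σ) + 2μ₀/Λ ≤ Δ` (the fast-remainder bound `slavedLadder_fast_le` is used as it stands);
* `slavedLadder_window_ge`: on a window `[t₀, t₁]` on which `g` is differentiable, for any primitive `G` of `g²` and every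
  `t ∈ [t₀, t₁]`: `Ψ(t) ≥ exp(−X(t))·Ψ(t₀)` with `X(t) = 2Λ(d₀(t−t₀) + (1+ε)σ(G t − G t₀)) + 2μ₀(t−t₀)`, and
  `0 ≤ X(t) ≤ X(t₁)` (needed downstream because `Ψ(t₀)` has no sign).

All constants are `W`-free. Trapezoid slot and cell instantiation are separate files. Part of the UPPER half of the K2R
bracket (energy LOWER bound for single long-wave modes); it does NOT prove anomalous dissipation.
-/

set_option linter.dupNamespace false -- layout D-0017: `AnomalousDissipation.AnomalousDissipation` repeats by design

namespace Summit.AnomalousDissipation.AnomalousDissipation.Theorems.SolenoidalFractalHomogenisation.RealisedQuasiStaticCellLaw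

noncomputable section

open Set Finset Complex
open scoped BigOperators ComplexConjugate

/-! ## §1 The two-sided slow-mode bound -/

/-- **Slow-mode bound of the slaved ladder, lower form.** At one instant: state `x` (window `W ∋ ±1`), slow field value
`Fv₀ = −Λ d₀ x₀ − gΛ(s₋₁ x₋₁ − s₀ x₁)`, slaving profile `hf`. Then, with `F = Σ_{J∈W∖0} ‖x_J − hf_J x₀‖²`,
`2 Re(Fv₀ conj x₀) ≥ −2Λ(d₀ + g²σ)‖x₀‖² − 2(|g| Λ γ ‖x₀‖ √F)` (same second-order slaving identity as
`slavedLadder_slow_le`, Cauchy–Schwarz applied on the other side). -/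
theorem slavedLadder_slow_ge (W : Finset ℤ) (h1 : (1 : ℤ) ∈ W) (hm1 : (-1 : ℤ) ∈ W)
    (d s : ℤ → ℝ) (Λ γ σ gt : ℝ) (x : ℤ → ℂ) (Fv0 : ℂ) (hf : ℤ → ℝ)
    (hγ : γ ^ 2 = s 0 ^ 2 + s (-1) ^ 2) (hγ0 : 0 ≤ γ)
    (hσ : σ = s (-1) ^ 2 / (d (-1) - d 0) + s 0 ^ 2 / (d 1 - d 0)) (hΛ : 0 < Λ)
    (hFv0 : Fv0 = -(Λ : ℂ) * ((d 0 : ℂ) * x 0) -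
      (gt : ℂ) * (Λ : ℂ) * ((s (0 - 1) : ℂ) * x (0 - 1) - (s 0 : ℂ) * x (0 + 1)))
    (hhf : ∀ J, hf J = if J = 1 then -(gt * s 0 / (d 1 - d 0))
      else if J = -1 then gt * s (-1) / (d (-1) - d 0) else 0) :
    -2 * Λ * (d 0 + gt ^ 2 * σ) * ‖x 0‖ ^ 2 -
      2 * (|gt| * Λ * γ * ‖x 0‖ * Real.sqrt (∑ J ∈ W.erase 0, ‖x J - (hf J : ℂ) * x 0‖ ^ 2)) ≤
      2 * (Fv0 * conj (x 0)).re := by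
  classical
  have h1W' : (1 : ℤ) ∈ W.erase 0 := Finset.mem_erase.2 ⟨by norm_num, h1⟩
  have hm1W' : (-1 : ℤ) ∈ W.erase 0 := Finset.mem_erase.2 ⟨by norm_num, hm1⟩
  have hf1 : hf 1 = -(gt * s 0 / (d 1 - d 0)) := by rw [hhf]; simp
  have hfm1 : hf (-1) = gt * s (-1) / (d (-1) - d 0) := by rw [hhf]; norm_num
  -- the slow feed `X₁ = s₋₁ r₋₁ − s₀ r₁` and its size
  obtain ⟨X₁, hX₁def⟩ : ∃ X₁ : ℂ, X₁ = (s (-1) : ℂ) * (x (-1) - (hf (-1) : ℂ) * x 0) -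
      (s 0 : ℂ) * (x 1 - (hf 1 : ℂ) * x 0) := ⟨_, rfl⟩
  obtain ⟨Y, hYdef⟩ : ∃ Y : ℝ, Y = Real.sqrt (∑ J ∈ W.erase 0, ‖x J - (hf J : ℂ) * x 0‖ ^ 2) := ⟨_, rfl⟩
  have hX₁ : ‖X₁‖ ≤ γ * Y := by
    have h := norm_sub_two_le_sqrt (s (-1)) (s 0) (x (-1) - (hf (-1) : ℂ) * x 0) (x 1 - (hf 1 : ℂ) * x 0)
    have e : Real.sqrt (s (-1) ^ 2 + s 0 ^ 2) = γ := by rw [← Real.sqrt_sq hγ0, hγ, add_comm]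
    rw [e, ← hX₁def] at h
    refine h.trans (mul_le_mul_of_nonneg_left ?_ hγ0)
    rw [hYdef]
    refine Real.sqrt_le_sqrt ?_
    have hsub : ({-1, 1} : Finset ℤ) ⊆ W.erase 0 := by
      intro J hJ
      simp only [Finset.mem_insert, Finset.mem_singleton] at hJ
      rcases hJ with rfl | rfl
      · exact hm1W'
      · exact h1W'
    have := Finset.sum_le_sum_of_subset_of_nonneg hsub (fun J _ _ => sq_nonneg ‖x J - (hf J : ℂ) * x 0‖)
    rw [Finset.sum_pair (by norm_num)] at this
    exact this
  -- KEY IDENTITY (second-order slaving): `s₋₁ x₋₁ − s₀ x₁ = X₁ + gt σ x₀`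
  have hslow_id : (s (-1) : ℂ) * x (-1) - (s 0 : ℂ) * x 1 = X₁ + ((gt * σ : ℝ) : ℂ) * x 0 := by
    rw [hX₁def, hf1, hfm1, hσ]
    push_cast
    ring
  have e0 : Fv0 = -(Λ : ℂ) * ((d 0 : ℂ) * x 0) - (gt : ℂ) * (Λ : ℂ) * (X₁ + ((gt * σ : ℝ) : ℂ) * x 0) := by
    rw [hFv0, ← hslow_id]; norm_num
  have e1 : Fv0 * conj (x 0) = -(((Λ * (d 0 + gt ^ 2 * σ) : ℝ) : ℂ) * (x 0 * conj (x 0))) -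
      ((gt * Λ : ℝ) : ℂ) * (X₁ * conj (x 0)) := by
    rw [e0]; push_cast; ring
  rw [← hYdef, e1, Complex.sub_re, Complex.neg_re, Complex.mul_conj', ← Complex.ofReal_pow, ← Complex.ofReal_mul,
    Complex.ofReal_re, Complex.re_ofReal_mul]
  have hY0 : 0 ≤ Y := by rw [hYdef]; exact Real.sqrt_nonneg _
  have hb : |(X₁ * conj (x 0)).re| ≤ γ * Y * ‖x 0‖ := ((Complex.abs_re_le_norm _).trans
    (le_of_eq (by rw [norm_mul, Complex.norm_conj]))).trans (mul_le_mul_of_nonneg_right hX₁ (norm_nonneg _))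
  have hb' : gt * Λ * (X₁ * conj (x 0)).re ≤ |gt| * Λ * (γ * Y * ‖x 0‖) := by
    have h2 : |gt * Λ * (X₁ * conj (x 0)).re| ≤ |gt| * Λ * (γ * Y * ‖x 0‖) := by
      rw [abs_mul, abs_mul, abs_of_pos hΛ]
      exact mul_le_mul_of_nonneg_left hb (by positivity)
    exact (le_abs_self _).trans h2
  linarith only [hb']

/-! ## §2 The pointwise inequality `Ψ' ≥ −2λ Ψ` -/

/-- **The slaved-ladder Lyapunov inequality, LOWER pointwise form.** Notation of the module docstring, at one instant:
state `x : ℤ → ℂ` vanishing off the window `W ∋ ±1`, ladder field `Fv`, coupling value `gt` (`|gt| ≤ g_T`) with time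
derivative `gdt` (`|gdt| ≤ g_D`), slaving profile `hf` and its time derivative `hd'`. Then the time derivative of
`Ψ = ‖x₀‖² − β Σ_{J≠0} ‖x_J − hf_J x₀‖²` along the ladder, namely
`2 Re(Fv₀ conj x₀) − β Σ_{J≠0} 2 Re((Fv_J − (hd'_J x₀ + hf_J Fv₀)) conj(x_J − hf_J x₀))`, is at least
`−2(Λ(d₀ + (1+ε)σ gt²) + μ₀)·Ψ`, `μ₀ = 4βγ²(Λg_T³σ + g_D + Λg_T²)²/(ΛΔ³)`, under `γ² ≤ βΔεσ` and the weak-coupling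
hypothesis `g_T²(4γ²/Δ + 2(1+ε)σ) + 2μ₀/Λ ≤ Δ`. -/
theorem slavedLadder_pointwise_ge (W : Finset ℤ) (h1 : (1 : ℤ) ∈ W) (hm1 : (-1 : ℤ) ∈ W)
    (d s : ℤ → ℝ) (Λ gT gD Δ γ σ ε β gt gdt : ℝ) (x Fv : ℤ → ℂ) (hf hd' : ℤ → ℝ)
    (hs : ∀ J ∈ W, |s J| ≤ 1) (hγ : γ ^ 2 = s 0 ^ 2 + s (-1) ^ 2) (hγ0 : 0 ≤ γ)
    (hσ : σ = s (-1) ^ 2 / (d (-1) - d 0) + s 0 ^ 2 / (d 1 - d 0))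
    (hΔ0 : 0 < Δ) (hΔ : ∀ J ∈ W, J ≠ 0 → d 0 + Δ ≤ d J) (hΛ : 0 < Λ) (hε : 0 ≤ ε) (hβ : 0 ≤ β)
    (hβγ : γ ^ 2 ≤ β * Δ * ε * σ) (hgt : |gt| ≤ gT) (hgdt : |gdt| ≤ gD)
    (hsmall : gT ^ 2 * (4 * γ ^ 2 / Δ + 2 * (1 + ε) * σ) +
      2 * (4 * β * γ ^ 2 * (Λ * gT ^ 3 * σ + gD + Λ * gT ^ 2) ^ 2 / (Λ * Δ ^ 3)) / Λ ≤ Δ)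
    (hx : ∀ K, K ∉ W → x K = 0)
    (hFv : ∀ J, Fv J = -(Λ : ℂ) * ((d J : ℂ) * x J) -
      (gt : ℂ) * (Λ : ℂ) * ((s (J - 1) : ℂ) * x (J - 1) - (s J : ℂ) * x (J + 1)))
    (hhf : ∀ J, hf J = if J = 1 then -(gt * s 0 / (d 1 - d 0))
      else if J = -1 then gt * s (-1) / (d (-1) - d 0) else 0)
    (hhd : ∀ J, hd' J = if J = 1 then -(gdt * s 0 / (d 1 - d 0))
      else if J = -1 then gdt * s (-1) / (d (-1) - d 0) else 0) :
    0 ≤ 2 * (Fv 0 * conj (x 0)).re -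
        β * ∑ J ∈ W.erase 0,
          2 * ((Fv J - ((hd' J : ℂ) * x 0 + (hf J : ℂ) * Fv 0)) * conj (x J - (hf J : ℂ) * x 0)).re +
      (2 * Λ * (d 0 + (1 + ε) * σ * gt ^ 2) +
          2 * (4 * β * γ ^ 2 * (Λ * gT ^ 3 * σ + gD + Λ * gT ^ 2) ^ 2 / (Λ * Δ ^ 3))) *
        (‖x 0‖ ^ 2 - β * ∑ J ∈ W.erase 0, ‖x J - (hf J : ℂ) * x 0‖ ^ 2) := by
  classical
  have hδp : Δ ≤ d 1 - d 0 := by linarith [hΔ 1 h1 (by norm_num)]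
  have hδm : Δ ≤ d (-1) - d 0 := by linarith [hΔ (-1) hm1 (by norm_num)]
  have hδp0 : 0 < d 1 - d 0 := lt_of_lt_of_le hΔ0 hδp
  have hδm0 : 0 < d (-1) - d 0 := lt_of_lt_of_le hΔ0 hδm
  have hσ0 : 0 ≤ σ := by rw [hσ]; positivity
  have hgT0 : 0 ≤ gT := (abs_nonneg _).trans hgt
  have hgD0 : 0 ≤ gD := (abs_nonneg _).trans hgdt
  have hgt2 : gt ^ 2 ≤ gT ^ 2 := by rw [← sq_abs]; exact pow_le_pow_left₀ (abs_nonneg _) hgt 2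
  -- names: `F` (fast energy), `V = ‖x₀‖`, `Y = √F`, `cB` (defect size), `μ₀` (slack)
  obtain ⟨F, hFdef⟩ : ∃ F : ℝ, F = ∑ J ∈ W.erase 0, ‖x J - (hf J : ℂ) * x 0‖ ^ 2 := ⟨_, rfl⟩
  have hF0 : 0 ≤ F := by rw [hFdef]; exact Finset.sum_nonneg fun J _ => by positivity
  obtain ⟨V, hVdef⟩ : ∃ V : ℝ, V = ‖x 0‖ := ⟨_, rfl⟩
  have hV0 : 0 ≤ V := by rw [hVdef]; exact norm_nonneg _
  obtain ⟨Y, hYdef⟩ : ∃ Y : ℝ, Y = Real.sqrt F := ⟨_, rfl⟩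
  have hY0 : 0 ≤ Y := by rw [hYdef]; exact Real.sqrt_nonneg _
  have hYsq : Y ^ 2 = F := by rw [hYdef]; exact Real.sq_sqrt hF0
  obtain ⟨cB, hcBdef⟩ : ∃ cB : ℝ, cB = γ * (Λ * gT ^ 3 * σ + gD + Λ * gT ^ 2) / Δ := ⟨_, rfl⟩
  have hcB0 : 0 ≤ cB := by rw [hcBdef]; positivity
  obtain ⟨μ₀, hμ₀def⟩ : ∃ μ₀ : ℝ, μ₀ = 4 * β * γ ^ 2 * (Λ * gT ^ 3 * σ + gD + Λ * gT ^ 2) ^ 2 / (Λ * Δ ^ 3) :=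
    ⟨_, rfl⟩
  have hμ₀0 : 0 ≤ μ₀ := by rw [hμ₀def]; positivity
  have hμ₀cB : μ₀ * (Λ * Δ) = 4 * β * cB ^ 2 := by rw [hμ₀def, hcBdef]; field_simp
  -- the two bounds
  have hslow := slavedLadder_slow_ge W h1 hm1 d s Λ γ σ gt x (Fv 0) hf hγ hγ0 hσ hΛ (hFv 0) hhf
  have hfast := slavedLadder_fast_le W h1 hm1 d s Λ gT gD Δ γ σ gt gdt x Fv hf hd' hs hγ hγ0 hσ hΔ0 hΔ hΛ
    hgt hgdt hx hFv hhf hhd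
  rw [← hFdef, ← hVdef, ← hYdef] at hslow
  rw [← hFdef, ← hVdef, ← hYdef, ← hcBdef] at hfast
  rw [← hFdef, ← hVdef, ← hμ₀def]
  rw [← hμ₀def] at hsmall
  -- AM–GM 1: the slow cross term against the fraction `ε` of the slaving rate and half of the fast dissipation
  have hAG1 : 2 * (|gt| * Λ * γ * V * Y) ≤ 2 * Λ * ε * σ * gt ^ 2 * V ^ 2 + β * Λ * Δ * Y ^ 2 / 2 := by
    refine two_mul_le_add_of_sq_le_mul (by positivity) (by positivity) ?_
    have e1 : (|gt| * Λ * γ * V * Y) ^ 2 = γ ^ 2 * (Λ ^ 2 * gt ^ 2 * V ^ 2 * Y ^ 2) := by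
      rw [show (|gt| * Λ * γ * V * Y) ^ 2 = |gt| ^ 2 * Λ ^ 2 * γ ^ 2 * V ^ 2 * Y ^ 2 by ring, sq_abs]; ring
    have e2 : 2 * Λ * ε * σ * gt ^ 2 * V ^ 2 * (β * Λ * Δ * Y ^ 2 / 2) =
        (β * Δ * ε * σ) * (Λ ^ 2 * gt ^ 2 * V ^ 2 * Y ^ 2) := by ring
    rw [e1, e2]
    exact mul_le_mul_of_nonneg_right hβγ (by positivity)
  -- AM–GM 2: the defect forcing against the slack `μ₀` and the other half of the fast dissipation
  have hAG2 : 2 * (2 * β * cB * V * Y) ≤ 2 * μ₀ * V ^ 2 + β * Λ * Δ * Y ^ 2 / 2 := by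
    have hP : 0 ≤ 2 * μ₀ * V ^ 2 := mul_nonneg (mul_nonneg zero_le_two hμ₀0) (sq_nonneg V)
    have hQ : 0 ≤ β * Λ * Δ * Y ^ 2 / 2 :=
      div_nonneg (mul_nonneg (mul_nonneg (mul_nonneg hβ hΛ.le) hΔ0.le) (sq_nonneg Y)) zero_le_two
    have hsq : (2 * β * cB * V * Y) ^ 2 ≤ 2 * μ₀ * V ^ 2 * (β * Λ * Δ * Y ^ 2 / 2) := by
      have e : 2 * μ₀ * V ^ 2 * (β * Λ * Δ * Y ^ 2 / 2) = (μ₀ * (Λ * Δ)) * β * V ^ 2 * Y ^ 2 := by ring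
      rw [e, hμ₀cB]
      exact le_of_eq (by ring)
    exact two_mul_le_add_of_sq_le_mul hP hQ hsq
  -- the `Y²`-coefficient: the fast dissipation `ΛΔ` dominates (weak coupling, now including the slack)
  have hYcoef : 4 * Λ * gT ^ 2 * γ ^ 2 / Δ + 2 * Λ * (1 + ε) * σ * gt ^ 2 + 2 * μ₀ ≤ Λ * Δ := by
    have h1a : σ * gt ^ 2 ≤ σ * gT ^ 2 := mul_le_mul_of_nonneg_left hgt2 hσ0
    have h1 : 2 * Λ * (1 + ε) * (σ * gt ^ 2) ≤ 2 * Λ * (1 + ε) * (σ * gT ^ 2) :=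
      mul_le_mul_of_nonneg_left h1a (by positivity)
    have h2 : Λ * (gT ^ 2 * (4 * γ ^ 2 / Δ + 2 * (1 + ε) * σ) + 2 * μ₀ / Λ) ≤ Λ * Δ :=
      mul_le_mul_of_nonneg_left hsmall hΛ.le
    have e : Λ * (gT ^ 2 * (4 * γ ^ 2 / Δ + 2 * (1 + ε) * σ) + 2 * μ₀ / Λ) =
        4 * Λ * gT ^ 2 * γ ^ 2 / Δ + 2 * Λ * (1 + ε) * (σ * gT ^ 2) + 2 * μ₀ := by
      field_simp
    have e2 : 2 * Λ * (1 + ε) * σ * gt ^ 2 = 2 * Λ * (1 + ε) * (σ * gt ^ 2) := by ring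
    linarith only [h1, h2, e, e2]
  -- assemble
  have hfast' := mul_le_mul_of_nonneg_left hfast hβ
  have hY2 : 0 ≤ β * F := by positivity
  rw [hYsq] at hAG1 hAG2
  have key : 0 ≤ (-2 * Λ * (d 0 + gt ^ 2 * σ) * V ^ 2 - 2 * (|gt| * Λ * γ * V * Y)) -
      β * (-2 * Λ * (d 0 + Δ) * F + 4 * (V * Y * cB) + 4 * (Λ * gT ^ 2 * γ ^ 2 * F / Δ)) +
        (2 * Λ * (d 0 + (1 + ε) * σ * gt ^ 2) + 2 * μ₀) * (V ^ 2 - β * F) := by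
    have hY3 := mul_le_mul_of_nonneg_left hYcoef hY2
    have e : (-2 * Λ * (d 0 + gt ^ 2 * σ) * V ^ 2 - 2 * (|gt| * Λ * γ * V * Y)) -
      β * (-2 * Λ * (d 0 + Δ) * F + 4 * (V * Y * cB) + 4 * (Λ * gT ^ 2 * γ ^ 2 * F / Δ)) +
        (2 * Λ * (d 0 + (1 + ε) * σ * gt ^ 2) + 2 * μ₀) * (V ^ 2 - β * F) =
        (2 * Λ * ε * σ * gt ^ 2 * V ^ 2 + 2 * μ₀ * V ^ 2 - 2 * (|gt| * Λ * γ * V * Y) -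
            2 * (2 * β * cB * V * Y)) +
          β * F * (2 * Λ * Δ - (4 * Λ * gT ^ 2 * γ ^ 2 / Δ + 2 * Λ * (1 + ε) * σ * gt ^ 2 + 2 * μ₀)) := by ring
    rw [e]
    linarith only [hAG1, hAG2, hY3]
  linarith only [key, hfast', hslow]

/-! ## §3 The integrated form on a window where the coupling is differentiable -/

/-- **The slaved-ladder functional, LOWER per-window bound.** In the setting of `slavedLadder_window` (window `W ∋ 0, ±1`,
links `|s_J| ≤ 1`, gap `d_J ≥ d₀ + Δ` off `0` with `d₀ ≥ 0`, rate `Λ > 0`, state `v` vanishing off `W`, coordinatewise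
`HasDerivWithinAt` on `[t₀, t₁]`, coupling `g` differentiable within `[t₀, t₁]` with `|g| ≤ g_T`, `|g'| ≤ g_D`, a primitive
`G` of `g²`), weight `β ≥ 0` with `γ² ≤ βΔεσ` and the weak-coupling hypothesis `g_T²(4γ²/Δ + 2(1+ε)σ) + 2μ₀/Λ ≤ Δ`,
`μ₀ = 4βγ²(Λg_T³σ + g_D + Λg_T²)²/(ΛΔ³)`: for every `t ∈ [t₀, t₁]`, with
`X(t) = 2Λ(d₀(t−t₀) + (1+ε)σ(G t − G t₀)) + 2μ₀(t−t₀)`,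
`exp(−X(t))·Ψ(t₀) ≤ Ψ(t)`, `Ψ(t) = ‖v₀(t)‖² − β Σ_{J∈W∖0} ‖v_J(t) − h_J(t)v₀(t)‖²`, and `0 ≤ X(t) ≤ X(t₁)`. -/
theorem slavedLadder_window_ge (W : Finset ℤ) (h0 : (0 : ℤ) ∈ W) (h1 : (1 : ℤ) ∈ W) (hm1 : (-1 : ℤ) ∈ W)
    (d s : ℤ → ℝ) (Λ gT gD Δ γ σ ε β t₀ t₁ : ℝ) (g g' G : ℝ → ℝ) (v : ℝ → ℤ → ℂ)
    (hs : ∀ J ∈ W, |s J| ≤ 1) (hγ : γ ^ 2 = s 0 ^ 2 + s (-1) ^ 2) (hγ0 : 0 ≤ γ)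
    (hσ : σ = s (-1) ^ 2 / (d (-1) - d 0) + s 0 ^ 2 / (d 1 - d 0))
    (hΔ0 : 0 < Δ) (hΔ : ∀ J ∈ W, J ≠ 0 → d 0 + Δ ≤ d J) (hd0 : 0 ≤ d 0) (hΛ : 0 < Λ) (hε : 0 ≤ ε) (hβ : 0 ≤ β)
    (hβγ : γ ^ 2 ≤ β * Δ * ε * σ)
    (hgT : ∀ t ∈ Icc t₀ t₁, |g t| ≤ gT) (hgD : ∀ t ∈ Icc t₀ t₁, |g' t| ≤ gD)
    (hg : ∀ t ∈ Icc t₀ t₁, HasDerivWithinAt g (g' t) (Icc t₀ t₁) t)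
    (hG : ∀ t ∈ Icc t₀ t₁, HasDerivWithinAt G (g t ^ 2) (Icc t₀ t₁) t)
    (hsmall : gT ^ 2 * (4 * γ ^ 2 / Δ + 2 * (1 + ε) * σ) +
      2 * (4 * β * γ ^ 2 * (Λ * gT ^ 3 * σ + gD + Λ * gT ^ 2) ^ 2 / (Λ * Δ ^ 3)) / Λ ≤ Δ)
    (hsupp : ∀ t ∈ Icc t₀ t₁, ∀ J, J ∉ W → v t J = 0)
    (hderiv : ∀ t ∈ Icc t₀ t₁, ∀ J ∈ W, HasDerivWithinAt (fun τ => v τ J)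
        (-(Λ : ℂ) * ((d J : ℂ) * v t J) -
          (g t : ℂ) * (Λ : ℂ) * ((s (J - 1) : ℂ) * v t (J - 1) - (s J : ℂ) * v t (J + 1))) (Icc t₀ t₁) t) :
    ∀ t ∈ Icc t₀ t₁,
      Real.exp (-(2 * Λ * (d 0 * (t - t₀) + (1 + ε) * σ * (G t - G t₀)) +
            2 * (4 * β * γ ^ 2 * (Λ * gT ^ 3 * σ + gD + Λ * gT ^ 2) ^ 2 / (Λ * Δ ^ 3)) * (t - t₀))) *
          (‖v t₀ 0‖ ^ 2 - β * ∑ J ∈ W.erase 0,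
            ‖v t₀ J - ((if J = 1 then -(g t₀ * s 0 / (d 1 - d 0))
                else if J = -1 then g t₀ * s (-1) / (d (-1) - d 0) else 0 : ℝ) : ℂ) * v t₀ 0‖ ^ 2) ≤
        ‖v t 0‖ ^ 2 - β * ∑ J ∈ W.erase 0,
          ‖v t J - ((if J = 1 then -(g t * s 0 / (d 1 - d 0))
              else if J = -1 then g t * s (-1) / (d (-1) - d 0) else 0 : ℝ) : ℂ) * v t 0‖ ^ 2 ∧
      0 ≤ 2 * Λ * (d 0 * (t - t₀) + (1 + ε) * σ * (G t - G t₀)) +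
            2 * (4 * β * γ ^ 2 * (Λ * gT ^ 3 * σ + gD + Λ * gT ^ 2) ^ 2 / (Λ * Δ ^ 3)) * (t - t₀) ∧
      2 * Λ * (d 0 * (t - t₀) + (1 + ε) * σ * (G t - G t₀)) +
            2 * (4 * β * γ ^ 2 * (Λ * gT ^ 3 * σ + gD + Λ * gT ^ 2) ^ 2 / (Λ * Δ ^ 3)) * (t - t₀) ≤
        2 * Λ * (d 0 * (t₁ - t₀) + (1 + ε) * σ * (G t₁ - G t₀)) +
            2 * (4 * β * γ ^ 2 * (Λ * gT ^ 3 * σ + gD + Λ * gT ^ 2) ^ 2 / (Λ * Δ ^ 3)) * (t₁ - t₀) := by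
  classical
  have hσ0 : 0 ≤ σ := by
    have hδp : 0 < d 1 - d 0 := by linarith [hΔ 1 h1 (by norm_num)]
    have hδm : 0 < d (-1) - d 0 := by linarith [hΔ (-1) hm1 (by norm_num)]
    rw [hσ]; positivity
  -- names for the profile, its time derivative, the field, the functional, the slack and the exponent
  obtain ⟨hf, hhf⟩ : ∃ hf : ℝ → ℤ → ℝ, hf = fun τ J => if J = 1 then -(g τ * s 0 / (d 1 - d 0))
      else if J = -1 then g τ * s (-1) / (d (-1) - d 0) else 0 := ⟨_, rfl⟩
  obtain ⟨hd', hhd⟩ : ∃ hd' : ℝ → ℤ → ℝ, hd' = fun τ J => if J = 1 then -(g' τ * s 0 / (d 1 - d 0))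
      else if J = -1 then g' τ * s (-1) / (d (-1) - d 0) else 0 := ⟨_, rfl⟩
  obtain ⟨Fv, hFv⟩ : ∃ Fv : ℝ → ℤ → ℂ, Fv = fun τ J => -(Λ : ℂ) * ((d J : ℂ) * v τ J) -
      (g τ : ℂ) * (Λ : ℂ) * ((s (J - 1) : ℂ) * v τ (J - 1) - (s J : ℂ) * v τ (J + 1)) := ⟨_, rfl⟩
  obtain ⟨Ψ, hΨ⟩ : ∃ Ψ : ℝ → ℝ, Ψ = fun τ =>
      ‖v τ 0‖ ^ 2 - β * ∑ J ∈ W.erase 0, ‖v τ J - ((hf τ J : ℝ) : ℂ) * v τ 0‖ ^ 2 := ⟨_, rfl⟩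
  obtain ⟨μ₀, hμ₀⟩ : ∃ μ₀ : ℝ, μ₀ = 4 * β * γ ^ 2 * (Λ * gT ^ 3 * σ + gD + Λ * gT ^ 2) ^ 2 / (Λ * Δ ^ 3) := ⟨_, rfl⟩
  have hμ₀0 : 0 ≤ μ₀ := by rw [hμ₀]; positivity
  obtain ⟨Ex, hEx⟩ : ∃ Ex : ℝ → ℝ, Ex = fun τ =>
      2 * Λ * (d 0 * (τ - t₀) + (1 + ε) * σ * (G τ - G t₀)) + 2 * μ₀ * (τ - t₀) := ⟨_, rfl⟩
  obtain ⟨D, hD⟩ : ∃ D : ℝ → ℝ, D = fun τ => 2 * (Fv τ 0 * conj (v τ 0)).re - β * ∑ J ∈ W.erase 0,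
      2 * ((Fv τ J - (((hd' τ J : ℝ) : ℂ) * v τ 0 + ((hf τ J : ℝ) : ℂ) * Fv τ 0)) *
        conj (v τ J - ((hf τ J : ℝ) : ℂ) * v τ 0)).re := ⟨_, rfl⟩
  -- Step 1: `Ψ' = D` within the window
  have hΨderiv : ∀ τ ∈ Icc t₀ t₁, HasDerivWithinAt Ψ (D τ) (Icc t₀ t₁) τ := by
    intro τ hτ
    have hvJ : ∀ J ∈ W, HasDerivWithinAt (fun τ' => v τ' J) (Fv τ J) (Icc t₀ t₁) τ := fun J hJ => by
      rw [hFv]; exact hderiv τ hτ J hJ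
    have hhfJ : ∀ J, HasDerivWithinAt (fun τ' => ((hf τ' J : ℝ) : ℂ)) ((hd' τ J : ℝ) : ℂ) (Icc t₀ t₁) τ := by
      intro J
      by_cases hJ1 : J = 1
      · subst hJ1
        have e1 : (fun τ' => ((hf τ' 1 : ℝ) : ℂ)) = fun τ' => (((-(g τ' * s 0 / (d 1 - d 0))) : ℝ) : ℂ) := by
          funext τ'; rw [hhf]; simp
        have e2 : hd' τ 1 = -(g' τ * s 0 / (d 1 - d 0)) := by rw [hhd]; simp
        rw [e1, e2]
        exact (((hg τ hτ).mul_const (s 0)).div_const (d 1 - d 0)).neg.ofReal_comp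
      · by_cases hJm1 : J = -1
        · subst hJm1
          have e1 : (fun τ' => ((hf τ' (-1) : ℝ) : ℂ)) = fun τ' => (((g τ' * s (-1) / (d (-1) - d 0)) : ℝ) : ℂ) := by
            funext τ'; rw [hhf]; norm_num
          have e2 : hd' τ (-1) = g' τ * s (-1) / (d (-1) - d 0) := by rw [hhd]; norm_num
          rw [e1, e2]
          exact (((hg τ hτ).mul_const (s (-1))).div_const (d (-1) - d 0)).ofReal_comp
        · have e1 : (fun τ' => ((hf τ' J : ℝ) : ℂ)) = fun _ => (0 : ℂ) := by
            funext τ'; rw [hhf]; simp [hJ1, hJm1]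
          have e2 : hd' τ J = 0 := by rw [hhd]; simp [hJ1, hJm1]
          rw [e1, e2, Complex.ofReal_zero]
          exact hasDerivWithinAt_const τ (Icc t₀ t₁) (0 : ℂ)
    have hrJ : ∀ J ∈ W.erase 0, HasDerivWithinAt (fun τ' => ‖v τ' J - ((hf τ' J : ℝ) : ℂ) * v τ' 0‖ ^ 2)
        (2 * ((Fv τ J - (((hd' τ J : ℝ) : ℂ) * v τ 0 + ((hf τ J : ℝ) : ℂ) * Fv τ 0)) *
          conj (v τ J - ((hf τ J : ℝ) : ℂ) * v τ 0)).re) (Icc t₀ t₁) τ := by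
      intro J hJ
      have h := ((hvJ J (Finset.mem_of_mem_erase hJ)).sub ((hhfJ J).mul (hvJ 0 h0))).norm_sq
      simp only [Complex.inner] at h
      exact h
    have h0' : HasDerivWithinAt (fun τ' => ‖v τ' 0‖ ^ 2) (2 * (Fv τ 0 * conj (v τ 0)).re) (Icc t₀ t₁) τ := by
      have h := (hvJ 0 h0).norm_sq
      simp only [Complex.inner] at h
      exact h
    have hsum := (HasDerivWithinAt.fun_sum hrJ).const_mul β
    have htot := h0'.sub hsum
    rw [hΨ, hD]
    exact htot
  -- Step 2: `0 ≤ D + Ex'·Ψ` pointwise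
  have hpoint : ∀ τ ∈ Icc t₀ t₁, 0 ≤ D τ + (2 * Λ * (d 0 + (1 + ε) * σ * g τ ^ 2) + 2 * μ₀) * Ψ τ := by
    intro τ hτ
    have hsmall' : gT ^ 2 * (4 * γ ^ 2 / Δ + 2 * (1 + ε) * σ) + 2 * μ₀ / Λ ≤ Δ := by rw [hμ₀]; exact hsmall
    have h := slavedLadder_pointwise_ge W h1 hm1 d s Λ gT gD Δ γ σ ε β (g τ) (g' τ) (v τ) (Fv τ) (hf τ) (hd' τ)
      hs hγ hγ0 hσ hΔ0 hΔ hΛ hε hβ hβγ (hgT τ hτ) (hgD τ hτ) (by rw [hμ₀] at hsmall'; exact hsmall') (hsupp τ hτ)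
      (fun J => by rw [hFv]) (fun J => by rw [hhf]) (fun J => by rw [hhd])
    rw [hD, hΨ, hμ₀]
    simpa only [sub_eq_add_neg, neg_mul, Finset.mul_sum, Finset.sum_neg_distrib] using h
  -- Step 3: `exp(Ex)·Ψ` is non-decreasing on the window
  have hExderiv : ∀ τ ∈ Icc t₀ t₁, HasDerivWithinAt Ex
      (2 * Λ * (d 0 + (1 + ε) * σ * g τ ^ 2) + 2 * μ₀) (Icc t₀ t₁) τ := by
    intro τ hτ
    have h1 : HasDerivWithinAt (fun τ' => τ' - t₀) 1 (Icc t₀ t₁) τ := (hasDerivWithinAt_id τ _).sub_const t₀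
    have h2 : HasDerivWithinAt (fun τ' => G τ' - G t₀) (g τ ^ 2) (Icc t₀ t₁) τ := (hG τ hτ).sub_const (G t₀)
    have h3 := (((h1.const_mul (d 0)).add (h2.const_mul ((1 + ε) * σ))).const_mul (2 * Λ)).add
      (h1.const_mul (2 * μ₀))
    rw [hEx]
    exact h3.congr_deriv (by ring)
  have hΦderiv : ∀ τ ∈ Icc t₀ t₁, HasDerivWithinAt (fun τ' => Real.exp (Ex τ') * Ψ τ')
      (Real.exp (Ex τ) * (2 * Λ * (d 0 + (1 + ε) * σ * g τ ^ 2) + 2 * μ₀) * Ψ τ + Real.exp (Ex τ) * D τ)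
      (Icc t₀ t₁) τ := fun τ hτ => ((hExderiv τ hτ).exp).mul (hΨderiv τ hτ)
  have hΦmono : MonotoneOn (fun τ' => Real.exp (Ex τ') * Ψ τ') (Icc t₀ t₁) := by
    refine monotoneOn_of_hasDerivWithinAt_nonneg (convex_Icc t₀ t₁)
      (f' := fun τ => Real.exp (Ex τ) * (2 * Λ * (d 0 + (1 + ε) * σ * g τ ^ 2) + 2 * μ₀) * Ψ τ +
        Real.exp (Ex τ) * D τ)
      (fun τ hτ => (hΦderiv τ hτ).continuousWithinAt) (fun τ hτ => ?_) (fun τ hτ => ?_)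
    · rw [interior_Icc] at hτ
      exact ((hΦderiv τ (Ioo_subset_Icc_self hτ)).mono (interior_subset)).mono_of_mem_nhdsWithin
        (by rw [interior_Icc]; exact self_mem_nhdsWithin)
    · rw [interior_Icc] at hτ
      have hτ' := Ioo_subset_Icc_self hτ
      have e : Real.exp (Ex τ) * (2 * Λ * (d 0 + (1 + ε) * σ * g τ ^ 2) + 2 * μ₀) * Ψ τ + Real.exp (Ex τ) * D τ =
          Real.exp (Ex τ) * (D τ + (2 * Λ * (d 0 + (1 + ε) * σ * g τ ^ 2) + 2 * μ₀) * Ψ τ) := by ring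
      rw [e]
      exact mul_nonneg (Real.exp_pos _).le (hpoint τ hτ')
  -- Step 4: `G` is non-decreasing on the window (its derivative is `g² ≥ 0`), hence `0 ≤ Ex ≤ Ex t₁`
  have hGmono : MonotoneOn G (Icc t₀ t₁) := by
    refine monotoneOn_of_hasDerivWithinAt_nonneg (convex_Icc t₀ t₁) (f' := fun τ => g τ ^ 2)
      (fun τ hτ => (hG τ hτ).continuousWithinAt) (fun τ hτ => ?_) (fun τ _ => sq_nonneg _)
    rw [interior_Icc] at hτ
    exact ((hG τ (Ioo_subset_Icc_self hτ)).mono (interior_subset)).mono_of_mem_nhdsWithin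
      (by rw [interior_Icc]; exact self_mem_nhdsWithin)
  -- conclusion
  intro t ht
  have ht₀ : t₀ ∈ Icc t₀ t₁ := ⟨le_rfl, ht.1.trans ht.2⟩; have ht₁ : t₁ ∈ Icc t₀ t₁ := ⟨ht.1.trans ht.2, le_rfl⟩
  have hmono := hΦmono ht₀ ht ht.1
  simp only at hmono
  have hEx0 : Ex t₀ = 0 := by rw [hEx]; simp
  rw [hEx0, Real.exp_zero, one_mul] at hmono
  -- `exp(−Ex t) Ψ t₀ ≤ Ψ t`
  have hΨt : Real.exp (-Ex t) * Ψ t₀ ≤ Ψ t := by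
    have hpos := Real.exp_pos (-Ex t)
    have := mul_le_mul_of_nonneg_left hmono hpos.le
    rwa [← mul_assoc, ← Real.exp_add, neg_add_cancel, Real.exp_zero, one_mul] at this
  have eΨ : ∀ τ, Ψ τ = ‖v τ 0‖ ^ 2 - β * ∑ J ∈ W.erase 0,
      ‖v τ J - ((if J = 1 then -(g τ * s 0 / (d 1 - d 0))
          else if J = -1 then g τ * s (-1) / (d (-1) - d 0) else 0 : ℝ) : ℂ) * v τ 0‖ ^ 2 := by
    intro τ; rw [hΨ, hhf]
  have eEx : ∀ τ, Ex τ = 2 * Λ * (d 0 * (τ - t₀) + (1 + ε) * σ * (G τ - G t₀)) +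
      2 * (4 * β * γ ^ 2 * (Λ * gT ^ 3 * σ + gD + Λ * gT ^ 2) ^ 2 / (Λ * Δ ^ 3)) * (τ - t₀) := by
    intro τ; rw [hEx, hμ₀]
  have hG0 : G t₀ ≤ G t := hGmono ht₀ ht ht.1; have hG1 : G t ≤ G t₁ := hGmono ht ht₁ ht.2
  refine ⟨?_, ?_, ?_⟩
  · rw [← eΨ t, ← eΨ t₀, ← eEx]
    exact hΨt
  · rw [← eEx, hEx]
    have h1 : 0 ≤ d 0 * (t - t₀) := mul_nonneg hd0 (by linarith [ht.1])
    have h2 : 0 ≤ (1 + ε) * σ * (G t - G t₀) := mul_nonneg (mul_nonneg (by linarith) hσ0) (by linarith)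
    have h3 : 0 ≤ 2 * μ₀ * (t - t₀) := mul_nonneg (mul_nonneg zero_le_two hμ₀0) (by linarith [ht.1])
    have h4 : 0 ≤ 2 * Λ * (d 0 * (t - t₀) + (1 + ε) * σ * (G t - G t₀)) :=
      mul_nonneg (mul_nonneg zero_le_two hΛ.le) (add_nonneg h1 h2)
    linarith only [h3, h4]
  · rw [← eEx, ← eEx, hEx]
    have h1 : d 0 * (t - t₀) ≤ d 0 * (t₁ - t₀) := mul_le_mul_of_nonneg_left (by linarith [ht.2]) hd0
    have h2 : (1 + ε) * σ * (G t - G t₀) ≤ (1 + ε) * σ * (G t₁ - G t₀) :=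
      mul_le_mul_of_nonneg_left (by linarith) (mul_nonneg (by linarith) hσ0)
    have h3 : 2 * μ₀ * (t - t₀) ≤ 2 * μ₀ * (t₁ - t₀) :=
      mul_le_mul_of_nonneg_left (by linarith [ht.2]) (mul_nonneg zero_le_two hμ₀0)
    have h4 : 2 * Λ * (d 0 * (t - t₀) + (1 + ε) * σ * (G t - G t₀)) ≤
        2 * Λ * (d 0 * (t₁ - t₀) + (1 + ε) * σ * (G t₁ - G t₀)) :=
      mul_le_mul_of_nonneg_left (add_le_add h1 h2) (mul_nonneg zero_le_two hΛ.le)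
    linarith only [h3, h4]

end

end Summit.AnomalousDissipation.AnomalousDissipation.Theorems.SolenoidalFractalHomogenisation.RealisedQuasiStaticCellLaw
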